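import Summits.CriticalPhenomena.PercolationContinuityZ3.Theses.PercTorusSliceFilling
import HarnessLib

/-!
# `stub_clusterExploration` (U1a) of line `registered` (crux `NoCriticalTorusGiant`,
# stmt-CriticalPhenomena-5407): exploration enumeration of a large open cluster

Registered stub `stub_clusterExploration` of the lead's skeleton
`Cruxes/NoCriticalTorusGiant/Lines/birth.lean` (reshape c3, stub U1a of the sprinkling-free
doubling inequality `P(∃ cluster ≥ 3k) ≤ P(∃ cluster ≥ k)²`).

Statement: for a bond configuration `ω` on the discrete torus `T_n = (ℤ/nℤ)³` and a vertex `x`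
whose open cluster `C(x) = openCluster ω x` has `Set.ncard C(x) ≥ m`, there is a map
`v : ℕ → T_n`, injective on `{0, …, m-1}`, with `v 0 = x`, such that every `v i` with
`0 < i < m` is joined by an OPEN edge `s(v j, v i) ∈ ω` to an earlier `v j` (`j < i`).

Proof (graph exploration, valid on any vertex type, `U1a.exists_exploration_mem`): induction on
`m` with the extra invariant `v i ∈ C(x)` for `i < m`.  For the step `m → m + 1` with `m ≥ 1`,
the enumerated set `S = v '' {0, …, m-1} ⊆ C(x)` has `ncard S ≤ m < m + 1 ≤ ncard C(x)` (so
`C(x)` is finite and `S ≠ C(x)`); pick `y ∈ C(x) ∖ S` and an open walk from `x ∈ S` to `y ∉ S`;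
a boundary dart of the walk (`SimpleGraph.Walk.exists_boundary_dart`) is an open edge from some
`v j ∈ S` to a new vertex `z ∉ S`, and `v m := z` extends the enumeration (the new vertex is in
`C(x)`, being adjacent to `v j ∈ C(x)`).  Mathlib only.
-/

namespace Summit.CriticalPhenomena.PercolationContinuityZ3.Theorems.PercTorusSliceFillingNoCriticalTorusGiant

open Literature.Probability.Percolation Literature.Probability.LatticeModels

namespace U1a

variable {V : Type*}

/-- Exploration enumeration with the cluster invariant (any vertex type): if
`m ≤ Set.ncard C(x)` then there is `v : ℕ → V`, injective on `Set.Iio m`, with `v 0 = x`,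
`v i ∈ C(x)` for all `i < m`, and every `v i` (`0 < i < m`) joined by an open edge
`s(v j, v i) ∈ ω` to an earlier `v j`, `j < i`.  Induction on `m`; the step uses a boundary dart
of an open walk from `x` to a cluster vertex not yet enumerated. -/
theorem exists_exploration_mem (ω : BondConfig V) (x : V) :
    ∀ m : ℕ, m ≤ (openCluster ω x).ncard →
      ∃ v : ℕ → V, Set.InjOn v (Set.Iio m) ∧ v 0 = x ∧ (∀ i, i < m → v i ∈ openCluster ω x) ∧
        ∀ i, 0 < i → i < m → ∃ j, j < i ∧ s(v j, v i) ∈ ω := by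
  intro m
  induction m with
  | zero =>
    intro _
    refine ⟨fun _ => x, ?_, rfl, ?_, ?_⟩
    · intro a ha
      simp at ha
    · intro i hi
      exact absurd hi (Nat.not_lt_zero i)
    · intro i _ hi
      exact absurd hi (Nat.not_lt_zero i)
  | succ m ih =>
    intro hm
    rcases Nat.eq_zero_or_pos m with rfl | hmpos
    · -- `m + 1 = 1`: the enumeration is `v 0 = x`
      refine ⟨fun _ => x, ?_, rfl, ?_, ?_⟩
      · intro a ha b hb _
        simp only [Set.mem_Iio] at ha hb
        omega
      · intro i _
        exact mem_openCluster_self ω x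
      · intro i hi0 hi
        omega
    · obtain ⟨v, hinj, h0, hmem, hpar⟩ := ih (Nat.le_of_succ_le hm)
      -- the enumerated set `S = v '' Iio m` is a proper subset of the (finite) cluster
      have hSsub : v '' Set.Iio m ⊆ openCluster ω x := by
        rintro _ ⟨i, hi, rfl⟩
        exact hmem i hi
      have hSfin : (v '' Set.Iio m).Finite := (Set.finite_Iio m).image v
      have hScard : (v '' Set.Iio m).ncard < (openCluster ω x).ncard :=
        calc (v '' Set.Iio m).ncard ≤ (Set.Iio m).ncard := Set.ncard_image_le (Set.finite_Iio m)
          _ = m := Set.ncard_Iio_nat m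
          _ < (openCluster ω x).ncard := Nat.lt_of_succ_le hm
      obtain ⟨y, hyC, hyS⟩ := Set.exists_mem_notMem_of_ncard_lt_ncard hScard hSfin
      have hxS : x ∈ v '' Set.Iio m := ⟨0, Set.mem_Iio.2 hmpos, h0⟩
      obtain ⟨p⟩ := (hyC : (openGraph ω).Reachable x y)
      obtain ⟨d, -, hdS, hdnS⟩ := p.exists_boundary_dart (v '' Set.Iio m) hxS hyS
      obtain ⟨j, hj, hjd⟩ := hdS
      have hjm : j < m := Set.mem_Iio.1 hj
      have hadj : (openGraph ω).Adj d.fst d.snd := d.adj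
      have hedge : s(d.fst, d.snd) ∈ ω := ((openGraph_adj ω _ _).1 hadj).1
      -- extend the enumeration by the new vertex `d.snd`
      refine ⟨fun i => if i < m then v i else d.snd, ?_, ?_, ?_, ?_⟩
      · intro a ha b hb hab
        simp only [Set.mem_Iio] at ha hb
        simp only at hab
        by_cases ham : a < m <;> by_cases hbm : b < m
        · rw [if_pos ham, if_pos hbm] at hab
          exact hinj (Set.mem_Iio.2 ham) (Set.mem_Iio.2 hbm) hab
        · rw [if_pos ham, if_neg hbm] at hab
          exact absurd ⟨a, Set.mem_Iio.2 ham, hab⟩ hdnS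
        · rw [if_neg ham, if_pos hbm] at hab
          exact absurd ⟨b, Set.mem_Iio.2 hbm, hab.symm⟩ hdnS
        · omega
      · simp only
        rw [if_pos hmpos]
        exact h0
      · intro i _
        simp only
        by_cases him : i < m
        · rw [if_pos him]
          exact hmem i him
        · rw [if_neg him]
          have hreach : (openGraph ω).Reachable x d.fst := hjd ▸ hmem j hjm
          exact hreach.trans hadj.reachable
      · intro i hi0 hi
        simp only
        by_cases him : i < m
        · obtain ⟨j', hj'i, hj'e⟩ := hpar i hi0 him
          refine ⟨j', hj'i, ?_⟩
          rw [if_pos him, if_pos (lt_trans hj'i him)]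
          exact hj'e
        · refine ⟨j, by omega, ?_⟩
          rw [if_neg him, if_pos hjm, hjd]
          exact hedge

end U1a

/-- **U1a — exploration enumeration of a large open cluster** (registered stub
`stub_clusterExploration` of `Cruxes/NoCriticalTorusGiant/Lines/birth.lean`).  If the open cluster
`C(x)` of a bond configuration `ω` on the torus `T_n` has at least `m` vertices
(`m ≤ Set.ncard C(x)`), then there is a map `v : ℕ → T_n`, injective on `{0, …, m-1}`, with
`v 0 = x`, such that every `v i` with `0 < i < m` is joined by an open edge `s(v j, v i) ∈ ω` to
some earlier `v j`, `j < i`.  Immediate from `U1a.exists_exploration_mem` (drop the cluster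
invariant). -/
theorem stub_clusterExploration : ∀ (n : ℕ) (ω : BondConfig (TorusSite 3 n)) (x : TorusSite 3 n) (m : ℕ), m ≤ (openCluster ω x).ncard → ∃ v : ℕ → TorusSite 3 n, Set.InjOn v (Set.Iio m) ∧ v 0 = x ∧ ∀ i, 0 < i → i < m → ∃ j, j < i ∧ s(v j, v i) ∈ ω := by
  intro n ω x m hm
  obtain ⟨v, hinj, h0, -, hpar⟩ := U1a.exists_exploration_mem ω x m hm
  exact ⟨v, hinj, h0, hpar⟩

end Summit.CriticalPhenomena.PercolationContinuityZ3.Theorems.PercTorusSliceFillingNoCriticalTorusGiant
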